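import Summits.ValiantsHypothesis.ValiantsHypothesis.Theses.BarrierLever
import Summits.ValiantsHypothesis.ValiantsHypothesis.Theorems.BarrierLeverPartitionMinorsChowIntegerCertificates
import Summits.ValiantsHypothesis.ValiantsHypothesis.Theorems.BarrierLeverPartitionMinorsGenericChowProduct

/-!
# Route BarrierLever — Chow witnesses for partition minors (item 20172, CPM): the CATALECTICANT
# NORMAL FORM of symmetric products `f(x, y) = g(x + y)` and the door
# «square-free catalecticant minors of ONE product of `2h` affine forms in `h` variables ⇒ CPM»

Helper file (`--supports stmt-ValiantsHypothesis-20172`; cell valiant-natproofs, rung V4, 𝒟-side of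
door (c); seat valiant-natproofs-prover gen 12 — the «named prover hour» on the symmetric design asked
for by planner valiant-natproofs-p1 g15 (MEMO-normalforms-g15 §3, Sketch.lean) / g16 (MEMO-ttdoor §7)
and the director's line of 2026-08-27T10:52Z).  Closes NO item; declares NO definition (the two
conjecture texts below appear only as HYPOTHESES, verbatim as the planner typed them).

Conventions of items 19717 / 20172 / 20195: `x_a = X (Fin.castAdd h a)`, `y_c = X (Fin.natAdd h c)`,
the partition exponent `E u w = Σ_{a ∈ u} e_{x_a} + Σ_{c ∈ w} e_{y_c}`; a layout `(u, w)`
(`u w : Fin r → Finset (Fin h)`) is HIT when some product of `h + h` affine forms `ℓ_k` has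
`det[coeff_{E (u i) (w j)} ∏ ℓ] ≠ 0`.

THE SYMMETRIC DESIGN.  Substitute `z_a ↦ x_a + y_a` (`MvPolynomial.aeval`) in ONE polynomial
`g ∈ R[z_1, …, z_h]`:

* `coeff_partitionExpo_aeval_add` — **catalecticant normal form** (every `g`, every commutative ring):
  `coeff_{E u w} g(x + y) = 2^{|u ∩ w|} · coeff_{1_u + 1_w} g`, where `1_u + 1_w ∈ {0,1,2}^h` is the
  exponent `Σ_{a∈u} e_a + Σ_{c∈w} e_c`.  So the partition matrix of `g(x + y)` is the SQUARE-FREE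
  HANKEL (catalecticant) matrix `(u, w) ↦ (∂^u ∂^w g)(0)` of `g` (planner's normal form 3).  Proof by
  `MvPolynomial.induction_on`: multiplying `g` by `z_n` multiplies `g(x+y)` by `x_n + y_n`, and the two
  up-operators on `(u, w)` reproduce the factor `2` exactly on `u ∩ w`.
* `totalDegree_aeval_add_le` — the substitution keeps affine forms affine.
* `det_partitionMinor_aeval_add` — for forms `m_k ∈ R[z]`: the partition minor of `∏_k m_k(x + y)` IS
  the catalecticant minor `det[2^{|u_i ∩ w_j|} coeff_{1_{u_i} + 1_{w_j}} ∏_k m_k]`.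
* `chow_hit_of_catalecticant` — **the door, one layout**: a nonzero square-free catalecticant minor of
  a product of `h + h` affine forms in `h` variables makes the layout Chow-hit (by `h + h` affine forms
  in the `2h` variables, as the items want).
* `chowHitsPartitionMinors_of_catalecticantMinors` — **the door, ∀h**: the planner's text
  `CatalecticantMinorsOfArrangements` (hypothesis, verbatim) ⇒ item 20172 `ChowHitsPartitionMinors`.
* `coeff_symmetricForms_eq_catalecticant`, `chowHitsPartitionMinors_of_symmetricForms` — the same for
  the planner's two-variable text `ChowHitsSymmetricForms` (forms `1 + Σ_a β k a · (x_a + y_a)`), and the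
  entrywise identity showing the two texts are one statement.

Evidence that the hypothesis is the right conjecture (planner g15/g16, kit j272783 / j272863 / j277694):
one symmetric product per height hits ALL 601 080 389 square layouts at `h = 4` and every sampled or
structured layout at `h ≤ 8`; print neighbour: DiPasquale–Flores–Peterson, «On the apolar algebra of a
product of linear forms» (ISSAC 2020) — rank, not minors.

WHAT THIS IS NOT: no layout is hit here and the hypothesis (CatCPM) is OPEN; nothing on items 20172 /
20195 / 19717 themselves, on crux stmt-ValiantsHypothesis-14610, or on `VP` versus `VNP`.
-/

set_option linter.dupNamespace false

namespace Summit.ValiantsHypothesis.ValiantsHypothesis.Theorems.BarrierLever.ChowFactor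

open Finset MvPolynomial
open Summit.ValiantsHypothesis.ValiantsHypothesis.Theorems.BarrierLever.ProductStateSums
  (partitionExpo_apply_castAdd partitionExpo_apply_natAdd)

noncomputable section

variable {h : ℕ}

/-! ## 1. The folded exponent `1_u + 1_w ∈ {0,1,2}^h` -/

/-- Value of the folded exponent at a coordinate. -/
theorem sumExpo_apply (u w : Finset (Fin h)) (a : Fin h) :
    ((∑ a' ∈ u, Finsupp.single a' 1 + ∑ c ∈ w, Finsupp.single c 1 : Fin h →₀ ℕ) : Fin h → ℕ) a =
      (if a ∈ u then 1 else 0) + (if a ∈ w then 1 else 0) := by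
  classical
  rw [Finsupp.add_apply, Finsupp.finsetSum_apply, Finsupp.finsetSum_apply]
  simp only [Finsupp.single_apply]
  rw [Finset.sum_ite_eq' u a, Finset.sum_ite_eq' w a]

/-- Support of the folded exponent: `u ∪ w`. -/
theorem mem_support_sumExpo (u w : Finset (Fin h)) (a : Fin h) :
    a ∈ (∑ a' ∈ u, Finsupp.single a' 1 + ∑ c ∈ w, Finsupp.single c 1 : Fin h →₀ ℕ).support ↔
      a ∈ u ∨ a ∈ w := by
  rw [Finsupp.mem_support_iff, sumExpo_apply]
  by_cases ha : a ∈ u <;> by_cases hc : a ∈ w <;> simp [ha, hc]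

/-- The folded exponent vanishes only at `(∅, ∅)`. -/
theorem sumExpo_eq_zero_iff (u w : Finset (Fin h)) :
    (∑ a' ∈ u, Finsupp.single a' 1 + ∑ c ∈ w, Finsupp.single c 1 : Fin h →₀ ℕ) = 0 ↔
      u = ∅ ∧ w = ∅ := by
  constructor
  · intro e
    have hz : ∀ a : Fin h, a ∉ u ∧ a ∉ w := fun a => by
      have := congrArg (fun f : Fin h →₀ ℕ => f a) e
      simp only [sumExpo_apply, Finsupp.coe_zero, Pi.zero_apply] at this
      by_cases ha : a ∈ u <;> by_cases hc : a ∈ w <;> simp [ha, hc] at this ⊢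
    exact ⟨Finset.eq_empty_of_forall_notMem fun a => (hz a).1,
      Finset.eq_empty_of_forall_notMem fun a => (hz a).2⟩
  · rintro ⟨rfl, rfl⟩
    simp

/-- Removing an `x`-element: `(1_u + 1_w) - e_a = 1_{u ∖ a} + 1_w` for `a ∈ u`. -/
theorem sumExpo_tsub_single_of_mem_left (u w : Finset (Fin h)) {a : Fin h} (ha : a ∈ u) :
    (∑ a' ∈ u, Finsupp.single a' 1 + ∑ c ∈ w, Finsupp.single c 1 : Fin h →₀ ℕ) -
        Finsupp.single a 1 =
      ∑ a' ∈ u.erase a, Finsupp.single a' 1 + ∑ c ∈ w, Finsupp.single c 1 := by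
  classical
  ext b
  rw [Finsupp.tsub_apply, sumExpo_apply, sumExpo_apply, Finsupp.single_apply]
  by_cases hb : a = b
  · subst hb
    simp [ha]
  · have hb' : b ≠ a := fun e => hb e.symm
    simp [hb, Finset.mem_erase, hb']

/-- Removing a `y`-element: `(1_u + 1_w) - e_c = 1_u + 1_{w ∖ c}` for `c ∈ w`. -/
theorem sumExpo_tsub_single_of_mem_right (u w : Finset (Fin h)) {c : Fin h} (hc : c ∈ w) :
    (∑ a' ∈ u, Finsupp.single a' 1 + ∑ c' ∈ w, Finsupp.single c' 1 : Fin h →₀ ℕ) -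
        Finsupp.single c 1 =
      ∑ a' ∈ u, Finsupp.single a' 1 + ∑ c' ∈ w.erase c, Finsupp.single c' 1 := by
  classical
  ext b
  rw [Finsupp.tsub_apply, sumExpo_apply, sumExpo_apply, Finsupp.single_apply]
  by_cases hb : c = b
  · subst hb
    by_cases hu : c ∈ u <;> simp [hc, hu]
  · have hb' : b ≠ c := fun e => hb e.symm
    simp [hb, Finset.mem_erase, hb']

/-- The partition exponent vanishes only at `(∅, ∅)`. -/
theorem partitionExpo_eq_zero_iff (u w : Finset (Fin h)) :
    (∑ a ∈ u, Finsupp.single (Fin.castAdd h a) 1 + ∑ c ∈ w, Finsupp.single (Fin.natAdd h c) 1 :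
        Fin (h + h) →₀ ℕ) = 0 ↔ u = ∅ ∧ w = ∅ := by
  constructor
  · intro e
    have hu : ∀ a : Fin h, a ∉ u := fun a ha => by
      have := congrArg (fun f : Fin (h + h) →₀ ℕ => f (Fin.castAdd h a)) e
      simp only [partitionExpo_apply_castAdd, if_pos ha, Finsupp.coe_zero, Pi.zero_apply] at this
      exact one_ne_zero this
    have hw : ∀ c : Fin h, c ∉ w := fun c hc => by
      have := congrArg (fun f : Fin (h + h) →₀ ℕ => f (Fin.natAdd h c)) e
      simp only [partitionExpo_apply_natAdd, if_pos hc, Finsupp.coe_zero, Pi.zero_apply] at this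
      exact one_ne_zero this
    exact ⟨Finset.eq_empty_of_forall_notMem hu, Finset.eq_empty_of_forall_notMem hw⟩
  · rintro ⟨rfl, rfl⟩
    simp

/-! ## 2. The catalecticant normal form of `g(x + y)` -/

/-- **CATALECTICANT NORMAL FORM.**  For every polynomial `g` in `h` variables over a commutative
semiring, the partition coefficient of `g(x + y)` (substitute `z_a ↦ x_a + y_a`) at the layout entry
`(u, w)` is `2^{|u ∩ w|}` times the coefficient of `g` at the folded exponent `1_u + 1_w`:
`coeff_{x^u y^w} g(x + y) = 2^{|u ∩ w|} · coeff_{z^{1_u + 1_w}} g = (∂^u ∂^w g)(0)`. -/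
theorem coeff_partitionExpo_aeval_add {R : Type*} [CommSemiring R] (g : MvPolynomial (Fin h) R)
    (u w : Finset (Fin h)) :
    coeff (∑ a ∈ u, Finsupp.single (Fin.castAdd h a) 1 + ∑ c ∈ w, Finsupp.single (Fin.natAdd h c) 1)
        (aeval (fun a : Fin h => (X (Fin.castAdd h a) + X (Fin.natAdd h a) :
          MvPolynomial (Fin (h + h)) R)) g) =
      2 ^ (u ∩ w).card * coeff (∑ a ∈ u, Finsupp.single a 1 + ∑ c ∈ w, Finsupp.single c 1) g := by
  classical
  induction g using MvPolynomial.induction_on generalizing u w with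
  | C r =>
    rw [aeval_C, algebraMap_eq, coeff_C, coeff_C]
    by_cases huw : u = ∅ ∧ w = ∅
    · obtain ⟨rfl, rfl⟩ := huw
      simp
    · rw [if_neg (fun e => huw ((partitionExpo_eq_zero_iff u w).mp e.symm)),
        if_neg (fun e => huw ((sumExpo_eq_zero_iff u w).mp e.symm)), mul_zero]
  | add p q hp hq =>
    rw [map_add, coeff_add, coeff_add, hp, hq, mul_add]
  | mul_X p n hp =>
    rw [map_mul, aeval_X, mul_add, coeff_add, coeff_mul_X', coeff_mul_X', coeff_mul_X']
    -- the `x_n`-term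
    have hx : (if Fin.castAdd h n ∈ (∑ a ∈ u, Finsupp.single (Fin.castAdd h a) 1 +
          ∑ c ∈ w, Finsupp.single (Fin.natAdd h c) 1 : Fin (h + h) →₀ ℕ).support then
        coeff ((∑ a ∈ u, Finsupp.single (Fin.castAdd h a) 1 +
          ∑ c ∈ w, Finsupp.single (Fin.natAdd h c) 1 : Fin (h + h) →₀ ℕ) -
            Finsupp.single (Fin.castAdd h n) 1)
          (aeval (fun a : Fin h => (X (Fin.castAdd h a) + X (Fin.natAdd h a) :
            MvPolynomial (Fin (h + h)) R)) p) else 0) =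
        if n ∈ u then 2 ^ (u.erase n ∩ w).card *
          coeff (∑ a ∈ u.erase n, Finsupp.single a 1 + ∑ c ∈ w, Finsupp.single c 1) p else 0 := by
      by_cases hn : n ∈ u
      · rw [if_pos ((castAdd_mem_support_partitionExpo u w n).mpr hn),
          partitionExpo_tsub_single_castAdd, hp, if_pos hn]
      · rw [if_neg (fun hm => hn ((castAdd_mem_support_partitionExpo u w n).mp hm)), if_neg hn]
    -- the `y_n`-term
    have hy : (if Fin.natAdd h n ∈ (∑ a ∈ u, Finsupp.single (Fin.castAdd h a) 1 +
          ∑ c ∈ w, Finsupp.single (Fin.natAdd h c) 1 : Fin (h + h) →₀ ℕ).support then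
        coeff ((∑ a ∈ u, Finsupp.single (Fin.castAdd h a) 1 +
          ∑ c ∈ w, Finsupp.single (Fin.natAdd h c) 1 : Fin (h + h) →₀ ℕ) -
            Finsupp.single (Fin.natAdd h n) 1)
          (aeval (fun a : Fin h => (X (Fin.castAdd h a) + X (Fin.natAdd h a) :
            MvPolynomial (Fin (h + h)) R)) p) else 0) =
        if n ∈ w then 2 ^ (u ∩ w.erase n).card *
          coeff (∑ a ∈ u, Finsupp.single a 1 + ∑ c ∈ w.erase n, Finsupp.single c 1) p else 0 := by
      by_cases hn : n ∈ w
      · rw [if_pos ((natAdd_mem_support_partitionExpo u w n).mpr hn),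
          partitionExpo_tsub_single, hp, if_pos hn]
      · rw [if_neg (fun hm => hn ((natAdd_mem_support_partitionExpo u w n).mp hm)), if_neg hn]
    rw [hx, hy]
    -- the `z_n`-term of `g`
    by_cases hnu : n ∈ u
    · by_cases hnw : n ∈ w
      · -- `n ∈ u ∩ w`: both up-operators hit, each with half the weight
        rw [if_pos hnu, if_pos hnw, if_pos ((mem_support_sumExpo u w n).mpr (Or.inl hnu)),
          sumExpo_tsub_single_of_mem_left u w hnu]
        have e2 : (∑ a ∈ u, Finsupp.single a 1 + ∑ c ∈ w.erase n, Finsupp.single c 1 : Fin h →₀ ℕ) =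
            ∑ a ∈ u.erase n, Finsupp.single a 1 + ∑ c ∈ w, Finsupp.single c 1 := by
          rw [← sumExpo_tsub_single_of_mem_right u w hnw, sumExpo_tsub_single_of_mem_left u w hnu]
        rw [e2]
        have hc1 : (u.erase n ∩ w).card + 1 = (u ∩ w).card := by
          rw [Finset.erase_inter, Finset.card_erase_of_mem (Finset.mem_inter.mpr ⟨hnu, hnw⟩)]
          exact Nat.sub_add_cancel (Finset.card_pos.mpr ⟨n, Finset.mem_inter.mpr ⟨hnu, hnw⟩⟩)
        have hc2 : (u ∩ w.erase n).card = (u.erase n ∩ w).card := by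
          rw [Finset.inter_erase, Finset.erase_inter]
        rw [hc2, ← hc1, pow_succ]
        ring
      · rw [if_pos hnu, if_neg hnw, add_zero, if_pos ((mem_support_sumExpo u w n).mpr (Or.inl hnu)),
          sumExpo_tsub_single_of_mem_left u w hnu]
        have hc : (u.erase n ∩ w).card = (u ∩ w).card := by
          rw [Finset.erase_inter, Finset.erase_eq_of_notMem]
          exact fun hm => hnw (Finset.mem_inter.mp hm).2
        rw [hc]
    · by_cases hnw : n ∈ w
      · rw [if_neg hnu, if_pos hnw, zero_add, if_pos ((mem_support_sumExpo u w n).mpr (Or.inr hnw)),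
          sumExpo_tsub_single_of_mem_right u w hnw]
        have hc : (u ∩ w.erase n).card = (u ∩ w).card := by
          rw [Finset.inter_erase, Finset.erase_eq_of_notMem]
          exact fun hm => hnu (Finset.mem_inter.mp hm).1
        rw [hc]
      · rw [if_neg hnu, if_neg hnw, add_zero,
          if_neg (fun hm => (not_or.mpr ⟨hnu, hnw⟩) ((mem_support_sumExpo u w n).mp hm)), mul_zero]

/-- The substitution `z ↦ x + y` keeps affine forms affine. -/
theorem totalDegree_aeval_add_le {R : Type*} [CommSemiring R] (m : MvPolynomial (Fin h) R)
    (hm : m.totalDegree ≤ 1) :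
    (aeval (fun a : Fin h => (X (Fin.castAdd h a) + X (Fin.natAdd h a) :
      MvPolynomial (Fin (h + h)) R)) m).totalDegree ≤ 1 := by
  classical
  rw [eq_affine_of_totalDegree_le_one m hm, map_add, map_sum, aeval_C, algebraMap_eq]
  refine (totalDegree_add _ _).trans (max_le ?_ ?_)
  · rw [totalDegree_C]
    exact Nat.zero_le _
  · refine (totalDegree_finsetSum _ _).trans (Finset.sup_le fun a _ => ?_)
    rw [map_mul, aeval_C, aeval_X, algebraMap_eq]
    refine (totalDegree_mul _ _).trans ?_
    have h1 : (C (coeff (Finsupp.single a 1) m) : MvPolynomial (Fin (h + h)) R).totalDegree = 0 :=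
      totalDegree_C _
    have h2 : ((X (Fin.castAdd h a) + X (Fin.natAdd h a) : MvPolynomial (Fin (h + h)) R)).totalDegree
        ≤ 1 :=
      (totalDegree_add _ _).trans (max_le (isHomogeneous_X R _).totalDegree_le
        (isHomogeneous_X R _).totalDegree_le)
    omega

/-- **The partition minor of `∏_k m_k(x + y)` is the catalecticant minor of `∏_k m_k`.** -/
theorem det_partitionMinor_aeval_add {R : Type*} [CommRing R] {ι : Type*} [Fintype ι] {r : ℕ}
    (u w : Fin r → Finset (Fin h)) (m : ι → MvPolynomial (Fin h) R) :
    (Matrix.of fun i j : Fin r =>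
        coeff (∑ a ∈ u i, Finsupp.single (Fin.castAdd h a) 1 +
            ∑ c ∈ w j, Finsupp.single (Fin.natAdd h c) 1)
          (∏ k, aeval (fun a : Fin h => (X (Fin.castAdd h a) + X (Fin.natAdd h a) :
            MvPolynomial (Fin (h + h)) R)) (m k))).det =
      (Matrix.of fun i j : Fin r =>
        (2 : R) ^ (u i ∩ w j).card *
          coeff (∑ a ∈ u i, Finsupp.single a 1 + ∑ c ∈ w j, Finsupp.single c 1) (∏ k, m k)).det := by
  congr 1
  ext i j
  rw [Matrix.of_apply, Matrix.of_apply, ← map_prod, coeff_partitionExpo_aeval_add]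

/-! ## 3. The door -/

/-- **THE CATALECTICANT DOOR, one layout.**  If some `h + h` affine forms `m_k` in `h` variables have
a nonzero square-free catalecticant minor `det[2^{|u_i ∩ w_j|} · coeff_{1_{u_i} + 1_{w_j}} ∏_k m_k]`,
then the layout `(u, w)` is hit by `h + h` affine forms in the `2h` variables, namely `m_k(x + y)`. -/
theorem chow_hit_of_catalecticant {r : ℕ} (u w : Fin r → Finset (Fin h))
    (m : Fin (h + h) → MvPolynomial (Fin h) ℂ) (hm : ∀ k, (m k).totalDegree ≤ 1)
    (hdet : (Matrix.of fun i j : Fin r =>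
      (2 : ℂ) ^ (u i ∩ w j).card *
        coeff (∑ a ∈ u i, Finsupp.single a 1 + ∑ c ∈ w j, Finsupp.single c 1) (∏ k, m k)).det ≠ 0) :
    ∃ ℓ : Fin (h + h) → MvPolynomial (Fin (h + h)) ℂ, (∀ q, (ℓ q).totalDegree ≤ 1) ∧
      (Matrix.of fun i j : Fin r => coeff
        (∑ b ∈ u i, Finsupp.single (Fin.castAdd h b) 1 + ∑ d ∈ w j, Finsupp.single (Fin.natAdd h d) 1)
        (∏ q, ℓ q)).det ≠ 0 := by
  refine ⟨fun k => aeval (fun a : Fin h => (X (Fin.castAdd h a) + X (Fin.natAdd h a) :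
      MvPolynomial (Fin (h + h)) ℂ)) (m k), fun k => totalDegree_aeval_add_le (m k) (hm k), ?_⟩
  rw [det_partitionMinor_aeval_add]
  exact hdet

/-- The planner's arrangement forms `1 + Σ_a β k a · z_a` are affine. -/
theorem totalDegree_arrangementForm_le (β : Fin (h + h) → Fin h → ℂ) (k : Fin (h + h)) :
    ((1 + ∑ a, C (β k a) * X a : MvPolynomial (Fin h) ℂ)).totalDegree ≤ 1 := by
  classical
  refine (totalDegree_add _ _).trans (max_le ?_ ?_)
  · rw [totalDegree_one]
    exact Nat.zero_le _
  · refine (totalDegree_finsetSum _ _).trans (Finset.sup_le fun a _ => ?_)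
    refine (totalDegree_mul _ _).trans ?_
    have h1 : (C (β k a) : MvPolynomial (Fin h) ℂ).totalDegree = 0 := totalDegree_C _
    have h2 : (X a : MvPolynomial (Fin h) ℂ).totalDegree ≤ 1 := (isHomogeneous_X ℂ a).totalDegree_le
    omega

/-- **THE CATALECTICANT DOOR, every height (planner valiant-natproofs-p1 g15's proposed support text
`CatalecticantMinorsOfArrangements`, taken verbatim as the hypothesis): if, for all large `h`, every
injective square layout has a nonzero square-free catalecticant minor at some product of `2h` affine
forms `1 + Σ_a β k a · z_a` in `h` variables, then item 20172 `ChowHitsPartitionMinors` holds.** -/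
theorem chowHitsPartitionMinors_of_catalecticantMinors
    (H : ∃ h₀ : ℕ, ∀ h : ℕ, h₀ ≤ h → ∀ (r : ℕ) (u w : Fin r → Finset (Fin h)), Function.Injective u →
      Function.Injective w → ∃ β : Fin (h + h) → Fin h → ℂ,
        (Matrix.of fun i j : Fin r =>
          (2 : ℂ) ^ ((u i) ∩ (w j)).card * MvPolynomial.coeff
            (∑ a ∈ u i, Finsupp.single a 1 + ∑ c ∈ w j, Finsupp.single c 1)
            (∏ k, (1 + ∑ a, C (β k a) * X a : MvPolynomial (Fin h) ℂ))).det ≠ 0) :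
    Theses.BarrierLever.ChowHitsPartitionMinors := by
  obtain ⟨h₀, H⟩ := H
  refine ⟨h₀, fun h hh r u w hu hw => ?_⟩
  obtain ⟨β, hβ⟩ := H h hh r u w hu hw
  exact chow_hit_of_catalecticant u w (fun k => 1 + ∑ a, C (β k a) * X a)
    (totalDegree_arrangementForm_le β) hβ

/-! ## 4. The two-variable text `ChowHitsSymmetricForms` is the same statement -/

/-- The symmetric forms `1 + Σ_a β k a · (x_a + y_a)` ARE the substituted arrangement forms. -/
theorem aeval_add_arrangementForm (β : Fin (h + h) → Fin h → ℂ) (k : Fin (h + h)) :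
    aeval (fun a : Fin h => (X (Fin.castAdd h a) + X (Fin.natAdd h a) : MvPolynomial (Fin (h + h)) ℂ))
        (1 + ∑ a, C (β k a) * X a : MvPolynomial (Fin h) ℂ) =
      1 + ∑ a, C (β k a) * (X (Fin.castAdd h a) + X (Fin.natAdd h a)) := by
  rw [map_add, map_one, map_sum]
  refine congrArg _ (Finset.sum_congr rfl fun a _ => ?_)
  rw [map_mul, aeval_C, aeval_X, algebraMap_eq]

/-- **Entrywise identity**: the partition matrix of the symmetric product `∏_k (1 + Σ_a β k a (x_a + y_a))`
is the square-free catalecticant matrix of the arrangement product `∏_k (1 + Σ_a β k a z_a)`. -/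
theorem coeff_symmetricForms_eq_catalecticant (β : Fin (h + h) → Fin h → ℂ) (u w : Finset (Fin h)) :
    coeff (∑ a ∈ u, Finsupp.single (Fin.castAdd h a) 1 + ∑ c ∈ w, Finsupp.single (Fin.natAdd h c) 1)
        (∏ k, (1 + ∑ a, C (β k a) * (X (Fin.castAdd h a) + X (Fin.natAdd h a)) :
          MvPolynomial (Fin (h + h)) ℂ)) =
      (2 : ℂ) ^ (u ∩ w).card *
        coeff (∑ a ∈ u, Finsupp.single a 1 + ∑ c ∈ w, Finsupp.single c 1)
          (∏ k, (1 + ∑ a, C (β k a) * X a : MvPolynomial (Fin h) ℂ)) := by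
  rw [← coeff_partitionExpo_aeval_add, map_prod]
  congr 1
  exact Finset.prod_congr rfl fun k _ => (aeval_add_arrangementForm β k).symm

/-- The symmetric forms have total degree `≤ 1` (planner g15's `totalDegree_symmetricForm_le`). -/
theorem totalDegree_symmetricForm_le (β : Fin (h + h) → Fin h → ℂ) (k : Fin (h + h)) :
    ((1 + ∑ a, C (β k a) * (X (Fin.castAdd h a) + X (Fin.natAdd h a)) :
      MvPolynomial (Fin (h + h)) ℂ)).totalDegree ≤ 1 := by
  rw [← aeval_add_arrangementForm]
  exact totalDegree_aeval_add_le _ (totalDegree_arrangementForm_le β k)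

/-- **Planner valiant-natproofs-p1 g15's arrow** `ChowHitsSymmetricForms → ChowHitsPartitionMinors`
(the two-variable text taken verbatim as the hypothesis): products of `h + h` affine forms SYMMETRIC
under `x_a ↔ y_a` already hit every square partition minor ⇒ item 20172. -/
theorem chowHitsPartitionMinors_of_symmetricForms
    (H : ∃ h₀ : ℕ, ∀ h : ℕ, h₀ ≤ h → ∀ (r : ℕ) (u w : Fin r → Finset (Fin h)), Function.Injective u →
      Function.Injective w → ∃ β : Fin (h + h) → Fin h → ℂ,
        (Matrix.of fun i j : Fin r => MvPolynomial.coeff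
          (∑ a ∈ u i, Finsupp.single (Fin.castAdd h a) 1 + ∑ c ∈ w j, Finsupp.single (Fin.natAdd h c) 1)
          (∏ k, (1 + ∑ a, C (β k a) * (X (Fin.castAdd h a) + X (Fin.natAdd h a)) :
            MvPolynomial (Fin (h + h)) ℂ))).det ≠ 0) :
    Theses.BarrierLever.ChowHitsPartitionMinors := by
  obtain ⟨h₀, H⟩ := H
  refine ⟨h₀, fun h hh r u w hu hw => ?_⟩
  obtain ⟨β, hβ⟩ := H h hh r u w hu hw
  exact ⟨fun k => 1 + ∑ a, C (β k a) * (X (Fin.castAdd h a) + X (Fin.natAdd h a)),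
    fun k => totalDegree_symmetricForm_le β k, hβ⟩

/-- **The two planner texts agree layout by layout**: the symmetric-forms minor IS the catalecticant
minor (so `ChowHitsSymmetricForms` and `CatalecticantMinorsOfArrangements` are one statement). -/
theorem det_symmetricForms_eq_catalecticant {r : ℕ} (β : Fin (h + h) → Fin h → ℂ)
    (u w : Fin r → Finset (Fin h)) :
    (Matrix.of fun i j : Fin r => MvPolynomial.coeff
        (∑ a ∈ u i, Finsupp.single (Fin.castAdd h a) 1 + ∑ c ∈ w j, Finsupp.single (Fin.natAdd h c) 1)
        (∏ k, (1 + ∑ a, C (β k a) * (X (Fin.castAdd h a) + X (Fin.natAdd h a)) :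
          MvPolynomial (Fin (h + h)) ℂ))).det =
      (Matrix.of fun i j : Fin r =>
        (2 : ℂ) ^ ((u i) ∩ (w j)).card * MvPolynomial.coeff
          (∑ a ∈ u i, Finsupp.single a 1 + ∑ c ∈ w j, Finsupp.single c 1)
          (∏ k, (1 + ∑ a, C (β k a) * X a : MvPolynomial (Fin h) ℂ))).det := by
  congr 1
  ext i j
  rw [Matrix.of_apply, Matrix.of_apply, coeff_symmetricForms_eq_catalecticant]

end

end Summit.ValiantsHypothesis.ValiantsHypothesis.Theorems.BarrierLever.ChowFactor
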